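import Summits.QuantumFields.YangMills.Theorems.BalabanUVNodesN14VarianceSocket

/-!
# BalabanUVNodes ∕ node N14 = NE1′ — THE ANOVA LEDGER of the class variance along the chain: old half = energies of the old
# increments; the two-run variance ledger with a crossover (LENS control, card 3 (ii)–(iv))

Cell `pub-ymgap`, HUMAN RULING D-0062 (Track A at full width), seat `pub-ymgap-dag-n14-c` (R134 ACCELERATION, strategy s1), generation 3;
route `Summits/QuantumFields/YangMills/Theses/BalabanUVNodes.lean` (cluster K3′ `SpineGivenEndpointR12`, `--supports … --as helper`); venue
ruling R424 (`YangMills/Theorems`, namespace `YMDAG.N14.VarianceSocket`, continued).  ADDITIVE — imports this seat's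
`…N14VarianceSocket.lean` (p468368 ✓: `energy_identity_antitone`, the socket `tiltedMeanMatching_of_variance`) ONLY; theorems only;
modifies nothing.

WHAT THIS IS.  The piece between the reverse-martingale energy identity (`…N14VarianceSocket` §2) and the variance socket (§1 there): for a
probability law `μ` (a tilted class law `(ν K τ).tilted (s·F K)` in the application), an antitone family `𝒢` of σ-algebras (the history-extended
RG chain's «present-and-future» σ-algebras) and `Φ ∈ L²(μ)`:
* `variance_condExp_eq_sum_energy_add` ∕ `variance_eq_sum_energy_add` — **ANOVA**: `Var[μ[Φ|𝒢 0]] = Σ_{k<K} ∫(μ[Φ|𝒢 k] − μ[Φ|𝒢 (k+1)])²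
  + Var[μ[Φ|𝒢 K]]` (energy identity + conservation of the mean `integral_condExp_eq_integral_condExp`); with `μ[Φ|𝒢 0] = Φ` a.e. the
  left side is `Var[Φ]`.  The class VARIANCE — unlike the tilted mean's dressing — decomposes additively over the scales.
* `abs_variance_sub_variance_le_young_add_old` ∕ `…_of_old_profiles` — **TWO RUNS WITH A CROSSOVER `j₀`**: the two total variances differ
  by at most the YOUNG discrepancy `|Var[μ′[Φ′|𝒢′ j₀]] − Var[μ[Φ|𝒢 j₀]]|` (same functionals under close laws: the undressed young rate) plus
  the SUM of both runs' OLD energies below `j₀` — with old profiles `vol·u k` (letter `u k = c·(θ₁²Λ)^{K−k}` under the engine of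
  `…N14CovGradEngine`) a geometric tail.  The variance-currency twin of `TiltedMeanCrossover.tiltedMeanMatching_of_profile`'s base ∕ old ∕
  young split; its output is the socket's `ηᵥ`.

WHAT THIS IS NOT.  [folklore] `L²` bookkeeping; which chain, which σ-algebras and which per-fibre energy bounds hold for Bałaban's runs is
NODE O's OBJECT (the per-old-fibre bound `∫(ΔN_k)² ≤ E[Var(Φ | fibre k)] ≤ θ₁^{2(K−k)}·C·n_k` is the engine `CovGradBound` read at `f = g`
on the history-conditioned fibre law — NOT asserted).  N14 NOT discharged; count-neutral.  One finite four-torus programme at fixed ε; NOT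
ℝ⁴, NOT OS, NOT a mass gap, NOT Clay.  0 sorry.
-/

noncomputable section

namespace YMDAG.N14.VarianceSocket

open MeasureTheory ProbabilityTheory Finset
open scoped ENNReal

/-! ## The ANOVA ledger of the variance along the chain: old half = energies of the old increments, two runs -/

section ANOVA

variable {Ω : Type*} {mΩ : MeasurableSpace Ω} {μ : Measure Ω} [IsProbabilityMeasure μ]

/-- MEANS ARE CONSERVED along the reverse martingale: `∫ μ[Φ|𝒢 j] dμ = ∫ μ[Φ|𝒢 k] dμ` (both `= ∫Φ dμ`; card 2's sum rule in its
simplest form — conditional expectations move no mass). [folklore] -/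
theorem integral_condExp_eq_integral_condExp (𝒢 : ℕ → MeasurableSpace Ω) (hle : ∀ k, 𝒢 k ≤ mΩ) (Φ : Ω → ℝ) (j k : ℕ) :
    ∫ ω, (μ[Φ|𝒢 j]) ω ∂μ = ∫ ω, (μ[Φ|𝒢 k]) ω ∂μ := by
  rw [integral_condExp (hle j), integral_condExp (hle k)]

/-- **ANOVA ALONG THE CHAIN** (LENS control, card 3 (ii)) [folklore].  `μ` a probability law (a tilted class law in the application),
`𝒢` antitone, `Φ ∈ L²(μ)`: the variance of `μ[Φ|𝒢 0]` DECOMPOSES ADDITIVELY over the scales,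
`Var[μ[Φ|𝒢 0]] = Σ_{k<K} ∫(μ[Φ|𝒢 k] − μ[Φ|𝒢 (k+1)])² dμ + Var[μ[Φ|𝒢 K]]` — the energy identity of §2 plus conservation of the mean.
Unlike the tilted MEAN's dressing, the class VARIANCE has a natively additive scale decomposition whose summands are energies of
increments (conditional variances over one step's fibre, in the application). -/
theorem variance_condExp_eq_sum_energy_add (𝒢 : ℕ → MeasurableSpace Ω) (h𝒢 : Antitone 𝒢) (hle : ∀ k, 𝒢 k ≤ mΩ) {Φ : Ω → ℝ}
    (hΦ : MemLp Φ 2 μ) (K : ℕ) :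
    Var[μ[Φ|𝒢 0]; μ] = (∑ k ∈ range K, ∫ ω, ((μ[Φ|𝒢 k]) ω - (μ[Φ|𝒢 (k + 1)]) ω) ^ 2 ∂μ) + Var[μ[Φ|𝒢 K]; μ] := by
  rw [energy_identity_antitone 𝒢 h𝒢 hle hΦ K, variance_eq_sub (hΦ.condExp one_le_two),
    variance_eq_sub (hΦ.condExp one_le_two), integral_condExp_eq_integral_condExp 𝒢 hle Φ K 0]
  simp only [Pi.pow_apply]
  ring

/-- The same with `Φ` itself on the left when the chain starts at the full σ-algebra (`μ[Φ|𝒢 0] = Φ` a.e., e.g. `𝒢 0 = mΩ`):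
`Var[Φ] = Σ_{k<K} energies + Var[μ[Φ|𝒢 K]]`. [folklore] -/
theorem variance_eq_sum_energy_add (𝒢 : ℕ → MeasurableSpace Ω) (h𝒢 : Antitone 𝒢) (hle : ∀ k, 𝒢 k ≤ mΩ) {Φ : Ω → ℝ}
    (hΦ : MemLp Φ 2 μ) (h0 : μ[Φ|𝒢 0] =ᵐ[μ] Φ) (K : ℕ) :
    Var[Φ; μ] = (∑ k ∈ range K, ∫ ω, ((μ[Φ|𝒢 k]) ω - (μ[Φ|𝒢 (k + 1)]) ω) ^ 2 ∂μ) + Var[μ[Φ|𝒢 K]; μ] := by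
  rw [← variance_congr h0]
  exact variance_condExp_eq_sum_energy_add 𝒢 h𝒢 hle hΦ K

variable {Ω' : Type*} {mΩ' : MeasurableSpace Ω'} {μ' : Measure Ω'} [IsProbabilityMeasure μ']

/-- **THE TWO-RUN VARIANCE LEDGER WITH A CROSSOVER** (LENS control, card 3 (ii)–(iv)) [folklore].  Two chains (run A on `Ω`, run B on `Ω′`),
crossover scale `j₀`: the discrepancy of the two total variances is at most the discrepancy of the YOUNG parts `Var[μ[Φ|𝒢 j₀]]` (matching
of the same functionals under close laws — the undressed young rate's business) plus the SUM of both runs' OLD energies below `j₀` (each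
natively second order under the engine of `…N14CovGradEngine` — no born term, no centring, no flatness).  This is the variance-currency
twin of `TiltedMeanCrossover.tiltedMeanMatching_of_profile`'s base ∕ old ∕ young split, feeding the socket's `ηᵥ`. -/
theorem abs_variance_sub_variance_le_young_add_old (𝒢 : ℕ → MeasurableSpace Ω) (h𝒢 : Antitone 𝒢) (hle : ∀ k, 𝒢 k ≤ mΩ)
    (𝒢' : ℕ → MeasurableSpace Ω') (h𝒢' : Antitone 𝒢') (hle' : ∀ k, 𝒢' k ≤ mΩ') {Φ : Ω → ℝ} {Φ' : Ω' → ℝ}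
    (hΦ : MemLp Φ 2 μ) (hΦ' : MemLp Φ' 2 μ') (j₀ : ℕ) :
    |Var[μ'[Φ'|𝒢' 0]; μ'] - Var[μ[Φ|𝒢 0]; μ]|
      ≤ |Var[μ'[Φ'|𝒢' j₀]; μ'] - Var[μ[Φ|𝒢 j₀]; μ]|
        + ∑ k ∈ range j₀, ((∫ ω, ((μ[Φ|𝒢 k]) ω - (μ[Φ|𝒢 (k + 1)]) ω) ^ 2 ∂μ)
          + ∫ ω, ((μ'[Φ'|𝒢' k]) ω - (μ'[Φ'|𝒢' (k + 1)]) ω) ^ 2 ∂μ') := by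
  rw [variance_condExp_eq_sum_energy_add 𝒢 h𝒢 hle hΦ j₀, variance_condExp_eq_sum_energy_add 𝒢' h𝒢' hle' hΦ' j₀, sum_add_distrib]
  set E := ∑ k ∈ range j₀, ∫ ω, ((μ[Φ|𝒢 k]) ω - (μ[Φ|𝒢 (k + 1)]) ω) ^ 2 ∂μ with hE
  set E' := ∑ k ∈ range j₀, ∫ ω, ((μ'[Φ'|𝒢' k]) ω - (μ'[Φ'|𝒢' (k + 1)]) ω) ^ 2 ∂μ' with hE'
  have hE0 : 0 ≤ E := sum_nonneg fun k _ => integral_nonneg fun ω => sq_nonneg _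
  have hE0' : 0 ≤ E' := sum_nonneg fun k _ => integral_nonneg fun ω => sq_nonneg _
  set V := Var[μ[Φ|𝒢 j₀]; μ] with hV
  set V' := Var[μ'[Φ'|𝒢' j₀]; μ'] with hV'
  calc |E' + V' - (E + V)| = |(V' - V) + (E' - E)| := by ring_nf
    _ ≤ |V' - V| + |E' - E| := abs_add_le _ _
    _ ≤ |V' - V| + (E + E') := by
        have h : |E' - E| ≤ E + E' := abs_sub_le_iff.mpr ⟨by linarith, by linarith⟩
        linarith

/-- **… WITH OLD PROFILES** [folklore]: if below the crossover each run's scale-`k` energy is at most `vol·u k` resp. `vol·u′ k` (in the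
application `u k = c·(θ₁²Λ)^{K−k}` from `…N14CovGradEngine.oldInfluenceProfile_of_secondOrder`'s letter), the two total variances agree
within the young discrepancy plus `vol·Σ_{k<j₀}(u k + u′ k)` — a geometric OLD tail when `θ₁²Λ < 1`. -/
theorem abs_variance_sub_variance_le_of_old_profiles (𝒢 : ℕ → MeasurableSpace Ω) (h𝒢 : Antitone 𝒢) (hle : ∀ k, 𝒢 k ≤ mΩ)
    (𝒢' : ℕ → MeasurableSpace Ω') (h𝒢' : Antitone 𝒢') (hle' : ∀ k, 𝒢' k ≤ mΩ') {Φ : Ω → ℝ} {Φ' : Ω' → ℝ}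
    (hΦ : MemLp Φ 2 μ) (hΦ' : MemLp Φ' 2 μ') {j₀ : ℕ} {vol : ℝ} {u u' : ℕ → ℝ}
    (hu : ∀ k < j₀, ∫ ω, ((μ[Φ|𝒢 k]) ω - (μ[Φ|𝒢 (k + 1)]) ω) ^ 2 ∂μ ≤ vol * u k)
    (hu' : ∀ k < j₀, ∫ ω, ((μ'[Φ'|𝒢' k]) ω - (μ'[Φ'|𝒢' (k + 1)]) ω) ^ 2 ∂μ' ≤ vol * u' k) :
    |Var[μ'[Φ'|𝒢' 0]; μ'] - Var[μ[Φ|𝒢 0]; μ]|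
      ≤ |Var[μ'[Φ'|𝒢' j₀]; μ'] - Var[μ[Φ|𝒢 j₀]; μ]| + vol * ∑ k ∈ range j₀, (u k + u' k) := by
  refine (abs_variance_sub_variance_le_young_add_old 𝒢 h𝒢 hle 𝒢' h𝒢' hle' hΦ hΦ' j₀).trans (add_le_add le_rfl ?_)
  rw [mul_sum]
  refine sum_le_sum fun k hk => ?_
  rw [mul_add]
  exact add_le_add (hu k (mem_range.mp hk)) (hu' k (mem_range.mp hk))

end ANOVA

end YMDAG.N14.VarianceSocket

end
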